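import Literature.NumberTheory.EllipticCurves.EisensteinSeriesTwoCharacterWeightOneCusps
import Literature.NumberTheory.EllipticCurves.EisensteinSeriesTwoCharacterWeightOneQExpansion
import Literature.NumberTheory.EllipticCurves.EisensteinSeriesTwoCharacterWeightTwoCusps
import HarnessLib

/-!
# Normalised constant terms of `S_1^{ψ,φ}` at the cusps with `gcd(c, u) = 1`, `p`-integrality

Topic `Literature/NumberTheory/EllipticCurves`; namespace
`Literature.NumberTheory.EllipticCurves.ModularForms`.  THEOREMS and one definition with body
(`twoCharOneUnit`); no named fact.  The weight-`1` twin of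
`EisensteinSeriesTwoCharacterWeightTwoCusps` (§ Normalised), for the level-raising products of
Billerey–Menares 2016, Thm. 2.2 in weight `k = 3`.

For `ψ ≠ 𝟙` primitive modulo `u`, `φ` primitive modulo `v`, `gcd(u, v) = 1` (and, for the
`q`-expansion, `φ ≠ 𝟙`, `ψ(-1)φ(-1) = -1`), the normalised form `S_1^{ψ,φ} / twoCharOneConst`
(coefficients `σ_0^{ψ,φ}(n) = ∑_{d ∣ n} ψ(n/d) φ(d)`, `a₀ = 0`;
`EisensteinSeriesTwoCharacterWeightOneQExpansion`) has, at a cusp `a/c` with `gcd(c, u) = 1`,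
constant term `0` if `v ∤ c` and `e₁ ψ(-c/v) φ(d)` if `v ∣ c`, with the **cusp unit**

  `e₁ = twoCharOneUnit ψ φ = -τ(Λ) B_{1,Λ̄} / (2 u τ(φ̄))`,  `Λ = ψφ̄ (mod uv)`

(`inv_twoCharOneConst_mul_twoCharOneCusp_of_not_dvd/_of_eq_mul`, from
`twoCharOneCusp_of_eq_mul_eq_bernoulli`); `e₁` is a `p`-adic unit as soon as `B_{1,Λ̄}` is and
`p ∤ 2uv` (`valuation_twoCharOneUnit_eq_one`; Gauss sums of primitive characters of level prime to
`p` are units), and all normalised coefficients are `p`-integral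
(`valuation_inv_twoCharOneConst_mul_coeff_le_one`).  (At the cusps with `gcd(c, u) > 1` the
constant term of `S_1^{ψ,φ}` need not vanish — weight one is symmetric in `ψ`, `φ` — but there the
weight-`2` companion `S_2^{ψ̄,𝟙}` of the level-raising product vanishes.)

## References

* F. Diamond, J. Shurman, *A First Course in Modular Forms*, GTM 228 (2005), §4.8 (Thm. 4.8.1).
  [DiamondShurman2005]
* T. M. Apostol, *Introduction to Analytic Number Theory* (1976), Thm. 8.11, Thm. 8.15. [Apostol1976]
-/

noncomputable section

open UpperHalfPlane hiding I
open EisensteinSeries ModularForm CongruenceSubgroup Complex Filter Finset DirichletCharacter Matrix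
  Literature.NumberTheory.LFunctions

open scoped Real MatrixGroups

namespace Literature.NumberTheory.EllipticCurves.ModularForms

section Normalised

variable {u v : ℕ} [NeZero u] [NeZero v] (ψ : DirichletCharacter ℂ u) (φ : DirichletCharacter ℂ v)

/-- **The cusp unit `e₁ = -τ(Λ) B_{1,Λ̄} / (2 u τ(φ̄))`**, `Λ = ψφ̄ (mod uv)`: the constant term of the
normalised form `S_1^{ψ,φ} / twoCharOneConst` at a cusp `a/c` with `v ∣ c`, `gcd(c, u) = 1` is
`e₁ ψ(-c/v) φ(d)`. [cite: DiamondShurman2005, Thm. 4.8.1] -/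
def twoCharOneUnit : ℂ :=
  -(gaussSum (changeLevel (dvd_mul_right u v) ψ * changeLevel (dvd_mul_left v u) φ⁻¹)
        (ZMod.stdAddChar (N := u * v)) *
      generalizedBernoulli 1
        (changeLevel (dvd_mul_right u v) ψ * changeLevel (dvd_mul_left v u) φ⁻¹)⁻¹) /
    (2 * u * gaussSum φ⁻¹ (ZMod.stdAddChar (N := v)))

/-- `twoCharOneConst ≠ 0` (`φ` primitive). [folklore] -/
theorem twoCharOneConst_ne_zero (hφ : φ.IsPrimitive) : twoCharOneConst u φ ≠ 0 := by
  have hW := gaussSum_ne_zero φ⁻¹ (Literature.NumberTheory.LFunctions.isPrimitive_inv φ hφ)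
  have hu0 : (u : ℂ) ≠ 0 := by exact_mod_cast NeZero.ne u
  have hπ : (2 * π * I : ℂ) ≠ 0 :=
    mul_ne_zero (mul_ne_zero two_ne_zero (by exact_mod_cast Real.pi_ne_zero)) I_ne_zero
  rw [twoCharOneConst]
  exact mul_ne_zero two_ne_zero (mul_ne_zero (mul_ne_zero (neg_ne_zero.mpr hπ) hu0) hW)

/-- **Normalised constant terms, `gcd(c, u) = 1`, `v ∤ c`**: zero (`ψ ≠ 𝟙`).
[cite: DiamondShurman2005, Thm. 4.8.1] -/
theorem inv_twoCharOneConst_mul_twoCharOneCusp_of_not_dvd (hψ1 : ψ ≠ 1) {γ : SL(2, ℤ)}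
    (hc : IsCoprime (γ 1 0 : ℤ) u) (h : ¬ (v : ℤ) ∣ γ 1 0) :
    (twoCharOneConst u φ)⁻¹ * twoCharOneCusp ψ φ γ = 0 := by
  rw [twoCharOneCusp_of_not_dvd ψ φ hψ1 hc h, mul_zero]

/-- **Normalised constant terms, `gcd(c, u) = 1`, `c = vc'`**: `e₁ ψ(-c') φ(d)`
(`ψ ≠ 𝟙` and `φ` primitive, `gcd(u, v) = 1`). [cite: DiamondShurman2005, Thm. 4.8.1] -/
theorem inv_twoCharOneConst_mul_twoCharOneCusp_of_eq_mul (hψ : ψ.IsPrimitive) (hψ1 : ψ ≠ 1)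
    (hφ : φ.IsPrimitive) (huv : u.Coprime v) {γ : SL(2, ℤ)} (c' : ℤ)
    (hcv : (γ 1 0 : ℤ) = v * c') (hc : IsCoprime (γ 1 0 : ℤ) u) :
    (twoCharOneConst u φ)⁻¹ * twoCharOneCusp ψ φ γ =
      twoCharOneUnit ψ φ * ψ ((-c' : ℤ) : ZMod u) * φ ((γ 1 1 : ℤ) : ZMod v) := by
  haveI : NeZero (u * v) := ⟨mul_ne_zero (NeZero.ne u) (NeZero.ne v)⟩
  have hW := gaussSum_ne_zero φ⁻¹ (Literature.NumberTheory.LFunctions.isPrimitive_inv φ hφ)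
  have hu0 : (u : ℂ) ≠ 0 := by exact_mod_cast NeZero.ne u
  have hπ : (π : ℂ) ≠ 0 := by exact_mod_cast Real.pi_ne_zero
  have hφa : φ⁻¹ ((γ 0 0 : ℤ) : ZMod v) = φ ((γ 1 1 : ℤ) : ZMod v) := by
    have hγv : γ ∈ CongruenceSubgroup.Gamma0 v := by
      rw [CongruenceSubgroup.Gamma0_mem, hcv]; push_cast; rw [ZMod.natCast_self, zero_mul]
    exact inv_apply00_eq_apply11 φ hγv
  rw [twoCharOneCusp_of_eq_mul_eq_bernoulli ψ φ hψ hψ1 hφ huv c' hcv hc, hφa, twoCharOneConst,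
    twoCharOneUnit]
  field_simp

variable {p : ℕ} [Fact p.Prime]

/-- **The cusp unit `e₁` is a `p`-adic unit** when `B_{1,Λ̄}` is and `p ∤ 2uv` (`ψ`, `φ` primitive with
coprime conductors). [cite: DiamondShurman2005, Thm. 4.8.1] [cite: Apostol1976, Thm. 8.15] -/
theorem valuation_twoCharOneUnit_eq_one (ι : PadicAlgCl p ≃+* ℂ) (hψ : ψ.IsPrimitive)
    (hφ : φ.IsPrimitive) (huv : u.Coprime v) (hpu : ¬ p ∣ u) (hpv : ¬ p ∣ v) (hp2 : p ≠ 2)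
    (hB : Valued.v (ι.symm (generalizedBernoulli 1
        (changeLevel (dvd_mul_right u v) ψ * changeLevel (dvd_mul_left v u) φ⁻¹)⁻¹)) = 1) :
    Valued.v (ι.symm (twoCharOneUnit ψ φ)) = 1 := by
  haveI : NeZero (u * v) := ⟨mul_ne_zero (NeZero.ne u) (NeZero.ne v)⟩
  set Λ := changeLevel (dvd_mul_right u v) ψ * changeLevel (dvd_mul_left v u) φ⁻¹ with hΛ
  have hΛp : Λ.IsPrimitive :=
    isPrimitive_changeLevel_mul_changeLevel huv hψ (Literature.NumberTheory.LFunctions.isPrimitive_inv φ hφ)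
  have hpuv : ¬ p ∣ u * v := fun h ↦ ((Nat.Prime.dvd_mul Fact.out).mp h).elim hpu hpv
  have hWΛ := valuation_symm_gaussSum_eq_one ι Λ hΛp hpuv
  have hWφ := valuation_symm_gaussSum_eq_one ι φ⁻¹ (Literature.NumberTheory.LFunctions.isPrimitive_inv φ hφ) hpv
  have hu1 : Valued.v (ι.symm (u : ℂ)) = 1 := valuation_symm_natCast_eq_one ι hpu
  have h2 : Valued.v (ι.symm (2 : ℂ)) = 1 := by
    have := valuation_symm_natCast_eq_one ι (n := 2)
      (fun h ↦ hp2 ((Nat.prime_dvd_prime_iff_eq Fact.out Nat.prime_two).mp h))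
    exact_mod_cast this
  rw [twoCharOneUnit, ← hΛ]
  simp only [map_div₀, map_mul, map_neg, Valuation.map_neg, hB, h2, hu1, hWΛ, hWφ, mul_one,
    div_one]

/-- **`p`-integrality of the normalised coefficients**: `v((twoCharOneConst)⁻¹ aₙ(S_1^{ψ,φ})) ≤ 1`
for all `n` (they are `0` and `σ_0^{ψ,φ}(n)`). [cite: DiamondShurman2005, Thm. 4.8.1] -/
theorem valuation_inv_twoCharOneConst_mul_coeff_le_one (ι : PadicAlgCl p ≃+* ℂ) (hψ1 : ψ ≠ 1)
    (hφ : φ.IsPrimitive) (hφ1 : φ ≠ 1) (hpar : ψ (-1) * φ (-1) = -1) (n : ℕ) :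
    Valued.v (ι.symm ((twoCharOneConst u φ)⁻¹ *
      (qExpansion 1 ⇑(twoCharOneMF ψ φ)).coeff n)) ≤ 1 := by
  rw [qExpansion_coeff_twoCharOneMF ψ φ hψ1 hφ hφ1 hpar n]
  split_ifs with hn
  · rw [mul_zero, map_zero, Valuation.map_zero]; exact zero_le
  · rw [← mul_assoc, inv_mul_cancel₀ (twoCharOneConst_ne_zero φ hφ), one_mul]
    have h := valuation_symm_divisorSum₂_le_one ι ψ φ 1 n
    simpa only [Nat.sub_self, pow_zero, mul_one] using h

end Normalised

end Literature.NumberTheory.EllipticCurves.ModularForms
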